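import Literature.MathematicalPhysics.QuantumFieldTheory.Balaban1983to89.B14Eq338Localization

/-!
# `Balaban1983to89.B14Eq331ChainRule` — CMP 119 (3.31) p. 273: the `t`-derivatives of the interpolated action terms
# ARE inner products `⟨𝐕′_k(tg_k, A), CA⟩` of a functional derivative with the field `CA` — the ray chain rule in the
# trace pairing (3.31), PROVED

statement-level skeleton of published theorems with citation tags; proofs where landed; nothing here is a claim
about the Yang–Mills mass gap.

CITATION HEADER (lean-in-tree rule).  Source: T. Bałaban, *Convergent renormalization expansions for lattice gauge
theories*, Commun. Math. Phys. **119**, 243–285 (1988), doi:10.1007/bf01217741 [Balaban1988Convergent] (cell paper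
B14 = "[III]"; held `paper:balaban1988-cmp119-convergent-renormalization`, journal page = PDF page + 242; p. 273 read
on the x2 render `…-p031-x2.png` and the text layer).  Mega-formalization `lit-balaban`, unit `lit-balaban-r11`
(CMP 119), SKELETON row **B14.Eq3.31–3.32** (the pairing `bondInner` of (3.31) is r11 gen 3 `B14Eq338Localization`,
p245677; (3.32) is `B14.InterpolationMeasure.eq332_family`, p243938).

THE PRINTED TEXT (p. 273, verbatim; the paragraph explaining the last term
`g_k ∫₀¹ dt ⟨(∂/∂tg_k) 𝐏^{(k)}(tg_k, A) + (∂/∂tg_k) 𝐄_k(U_k(…tg_kCA…))⟩_t` of (3.30)): *"[Consider the] derivatives in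
the last term, in the expectation value. They can be expressed as inner products of functional derivatives of some
functions of tg_kCA, with the field CA. This is obvious for all terms in the effective action, as displayed in the
formula (2.12) [I], maybe with the exception of the terms divided by (tg_k)². These we expand up to the second order
with respect to tg_kCA. We use the fact that the lower-order terms vanish, and we represent the remainders by quadratic
forms in A, as in (6.42) [I]. The coefficients are functions of tg_kCA, and the differentiation with respect to tg_k
yields such an inner product. Thus the derivatives in the expectation value can be written as
  ⟨𝐕_k′(tg_k, A), CA⟩ = Σ_{b∈Λ^{(k)}_{k+1}} tr 𝐕_k′(tg_k, A, b)(CA)(b),   (3.31)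
where 𝐕_k′ is the sum of all the functional derivatives."*

WHAT IS PROVED — the representation claim print ARGUES here (lead g12, HEAD WORDS Q-B14-96-2, 2026-08-23T09:36:36Z:
option (b), "land the finite-dimensional chain rule along the ray t ↦ tg_kCA with ∇ taken in `bondInner`").  The model:
bond functions `β → Matrix n n ℂ` on the finite bond range `β = Λ^{(k)}_{k+1}` with values in `n × n` complex matrices
(the complexified Lie algebra in a matrix realisation — the carrier of `B14.Eq338Localization.bondInner`, (3.31)'s
pairing `⟨V, W⟩ = Σ_b tr V(b) W(b)`), a term `W` of the action as a function on that space, complex-differentiable at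
the point in question ([III]'s terms are analytic functions on the spaces (3.43), p. 277).
* §1 THE TRACE PAIRING IS PERFECT: every `ℂ`-linear functional `φ` on bond functions is `⟨V, ·⟩` for exactly one bond
  function `V` — namely `V = funcDeriv φ`, `(funcDeriv φ)(b)_{ij} = φ(δ_b E_{ji})` (`bondInner_funcDeriv`,
  `funcDeriv_unique`); this is what makes *"the functional derivative"* `𝐕′(b)` of a differentiable `W` a well-defined
  matrix-valued bond function: `funcDeriv (fderiv W)`.
* §2 (3.31) PROPER, the sentence *"the differentiation with respect to tg_k yields such an inner product"*: along the ray
  `s ↦ s·H` (`s = tg_k` real, `H = CA`), `d/ds W(sH) = ⟨𝐕′(sH), H⟩ = Σ_b tr 𝐕′(sH)(b) H(b)` with `𝐕′ = funcDeriv` of the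
  Fréchet derivative (`hasDerivAt_ray`); and in the interpolation parameter `t` itself, `d/dt W(tg_k·H) = g_k ⟨𝐕′, H⟩`
  (`hasDerivAt_coupling`) — the factor `g_k` in front of `∫₀¹ dt` in (3.30).  For a SUM of terms the functional
  derivatives add (`funcDeriv_add`) — *"𝐕_k′ is the sum of all the functional derivatives"*.
SCOPE.  The "terms divided by (tg_k)²" are, after print's second-order expansion "as in (6.42) [I]" (row B13.Eq6.42, a
pointer), quadratic forms `⟨A, K(tg_kCA)A⟩` whose coefficients are functions of `tg_kCA`: with `A` a parameter these are
again functions `W_A(Z) = ⟨A, K(Z)A⟩` of `Z = tg_kCA`, to which §2 applies verbatim — no separate statement.  The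
expectation `⟨·⟩_t` and the objects `𝐏^{(k)}`, `𝐄_k`, `C` of Bałaban's spaces are not modelled here (rows B14.Eq3.30,
B14.Eq3.37–3.39); (3.32) and its Leibniz sentence are `eq332_family` / `hasDerivAt_chiProd` (tree).  No `sorry`.
-/

noncomputable section

open Finset
open scoped BigOperators

namespace Literature.MathematicalPhysics.QuantumFieldTheory.Balaban1983to89.B14.Eq331ChainRule

open B14.Eq338Localization (bondInner)

variable {β : Type*} [Fintype β] [DecidableEq β] {n : Type*} [Fintype n] [DecidableEq n]

/-! ## §1  The trace pairing (3.31) is perfect: functional derivatives as bond functions -/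

/-- The elementary bond functions `δ_b E_{ij}`: the matrix unit `E_{ij}` at the bond `b`, zero elsewhere. [folklore] -/
def bondBasis (b : β) (i j : n) : β → Matrix n n ℂ := Pi.single b (Matrix.single i j 1)

omit [Fintype β] [Fintype n] in
/-- Entries of the elementary bond functions. [folklore] -/
@[simp] private theorem bondBasis_apply (b b' : β) (i j i' j' : n) :
    bondBasis b i j b' i' j' = if b' = b then (if i = i' ∧ j = j' then 1 else 0) else 0 := by
  unfold bondBasis
  by_cases h : b' = b
  · subst h; simp [Matrix.single_apply]
  · simp [h]

/-- Pairing with `δ_b E_{ij}` reads off the `(j,i)` entry at `b`: `⟨V, δ_b E_{ij}⟩ = V(b)_{ji}`.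
[cite: Balaban1988Convergent, (3.31) p.273] -/
theorem bondInner_bondBasis (V : β → Matrix n n ℂ) (b : β) (i j : n) :
    bondInner V (bondBasis b i j) = V b j i := by
  unfold bondInner bondBasis
  rw [Finset.sum_eq_single b]
  · simp [Matrix.trace_mul_single]
  · intro b' _ hb'; simp [hb']
  · intro h; exact absurd (Finset.mem_univ b) h

/-- Every bond function is the sum of its entries times the elementary bond functions (the expansion behind the
bond-wise form `Σ_b tr V(b) W(b)` of (3.31)). [cite: Balaban1988Convergent, (3.31) p.273] -/
theorem eq_sum_bondBasis (H : β → Matrix n n ℂ) : H = ∑ b, ∑ i, ∑ j, H b i j • bondBasis b i j := by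
  funext b'
  ext i' j'
  simp only [Finset.sum_apply, Matrix.sum_apply, Pi.smul_apply, Matrix.smul_apply, bondBasis_apply, smul_eq_mul,
    mul_ite, mul_one, mul_zero]
  rw [Finset.sum_eq_single_of_mem b' (Finset.mem_univ _) (fun b _ hb => by simp [Ne.symm hb])]
  simp only [if_true]
  rw [Finset.sum_eq_single_of_mem i' (Finset.mem_univ _) (fun i _ hi => by simp [hi]),
    Finset.sum_eq_single_of_mem j' (Finset.mem_univ _) (fun j _ hj => by simp [hj])]
  simp

/-- The pairing (3.31) is non-degenerate: `⟨V, ·⟩ = ⟨V′, ·⟩` forces `V = V′`. [cite: Balaban1988Convergent, (3.31) p.273] -/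
theorem bondInner_left_cancel {V V' : β → Matrix n n ℂ} (h : ∀ H, bondInner V H = bondInner V' H) : V = V' := by
  ext b i j
  simpa [bondInner_bondBasis] using h (bondBasis b j i)

/-- **The functional derivative in the trace pairing.**  For a `ℂ`-linear continuous functional `φ` on bond functions
(read: the Fréchet derivative `fderiv W (·)` of an action term), `funcDeriv φ` is the matrix-valued bond function with
entries `(funcDeriv φ)(b)_{ij} = φ(δ_b E_{ji})` — the unique `V` with `φ = ⟨V, ·⟩` (`bondInner_funcDeriv`,
`funcDeriv_unique`): print's `𝐕′(tg_k, A, b)`. [cite: Balaban1988Convergent, (3.31) p.273] -/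
def funcDeriv (φ : (β → Matrix n n ℂ) →L[ℂ] ℂ) : β → Matrix n n ℂ := fun b => Matrix.of fun i j => φ (bondBasis b j i)

omit [Fintype β] [Fintype n] in
/-- Entries of the functional derivative: `𝐕′(b)_{ij} = φ(δ_b E_{ji})`. [cite: Balaban1988Convergent, (3.31) p.273] -/
@[simp] theorem funcDeriv_apply (φ : (β → Matrix n n ℂ) →L[ℂ] ℂ) (b : β) (i j : n) :
    funcDeriv φ b i j = φ (bondBasis b j i) := rfl

/-- **Representation**: `⟨funcDeriv φ, H⟩ = φ(H)` for every bond function `H`. [cite: Balaban1988Convergent, (3.31) p.273] -/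
theorem bondInner_funcDeriv (φ : (β → Matrix n n ℂ) →L[ℂ] ℂ) (H : β → Matrix n n ℂ) :
    bondInner (funcDeriv φ) H = φ H := by
  conv_rhs => rw [eq_sum_bondBasis H]
  simp only [map_sum, map_smul, smul_eq_mul]
  unfold bondInner
  refine Finset.sum_congr rfl fun b _ => ?_
  simp only [Matrix.trace, Matrix.diag_apply, Matrix.mul_apply, funcDeriv_apply]
  conv_lhs => rw [Finset.sum_comm]
  exact Finset.sum_congr rfl fun i _ => Finset.sum_congr rfl fun j _ => mul_comm _ _

/-- **Uniqueness**: a bond function representing `φ` in the trace pairing IS `funcDeriv φ` — the functional derivative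
`𝐕′` of (3.31) is determined by the display. [cite: Balaban1988Convergent, (3.31) p.273] -/
theorem funcDeriv_unique {φ : (β → Matrix n n ℂ) →L[ℂ] ℂ} {V : β → Matrix n n ℂ} (h : ∀ H, bondInner V H = φ H) :
    V = funcDeriv φ :=
  bondInner_left_cancel fun H => by rw [h, bondInner_funcDeriv]

omit [Fintype β] [Fintype n] in
/-- *"𝐕_k′ is the sum of all the functional derivatives"*: `funcDeriv` is additive in the functional (the derivative of
a sum of terms is the sum of the derivatives). [cite: Balaban1988Convergent, (3.31) p.273] -/
theorem funcDeriv_add (φ ψ : (β → Matrix n n ℂ) →L[ℂ] ℂ) : funcDeriv (φ + ψ) = funcDeriv φ + funcDeriv ψ := by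
  ext b i j; simp

omit [Fintype β] [Fintype n] in
/-- *"𝐕_k′ is the sum of all the functional derivatives"*, finite-sum form. [cite: Balaban1988Convergent, (3.31) p.273] -/
theorem funcDeriv_sum {ι : Type*} (s : Finset ι) (φ : ι → (β → Matrix n n ℂ) →L[ℂ] ℂ) :
    funcDeriv (∑ l ∈ s, φ l) = ∑ l ∈ s, funcDeriv (φ l) := by
  ext b i j; simp [Finset.sum_apply, Matrix.sum_apply]

/-! ## §2  (3.31): differentiation along the ray `tg_k·CA` yields the inner product `⟨𝐕′, CA⟩` -/

section Ray

open scoped Matrix.Norms.Elementwise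

/-- **(3.31), the ray chain rule in the trace pairing.**  Let `W` be a term of the action as a function of the bond
field, complex-differentiable at `s·H` with Fréchet derivative `φ` (`s = tg_k` real, `H = CA`).  Then
`d/ds W(s·H) = ⟨𝐕′, H⟩ = Σ_b tr 𝐕′(b) H(b)` with `𝐕′ = funcDeriv φ` the functional derivative of `W` at `s·H` — print's
*"the differentiation with respect to tg_k yields such an inner product … ⟨𝐕_k′(tg_k, A), CA⟩ =
Σ_b tr 𝐕_k′(tg_k, A, b)(CA)(b)"*. [cite: Balaban1988Convergent, (3.31) p.273] -/
theorem hasDerivAt_ray {W : (β → Matrix n n ℂ) → ℂ} {φ : (β → Matrix n n ℂ) →L[ℂ] ℂ} {H : β → Matrix n n ℂ} {s : ℝ}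
    (hW : HasFDerivAt W φ (s • H)) :
    HasDerivAt (fun s : ℝ => W (s • H)) (bondInner (funcDeriv φ) H) s := by
  have hc : HasDerivAt (fun s : ℝ => s • H) ((1 : ℝ) • H) s := (hasDerivAt_id s).smul_const H
  have h : HasDerivAt (fun s : ℝ => W (s • H)) ((φ.restrictScalars ℝ) ((1 : ℝ) • H)) s :=
    (hW.restrictScalars ℝ).comp_hasDerivAt s hc
  refine h.congr_deriv ?_
  rw [one_smul, ContinuousLinearMap.coe_restrictScalars', bondInner_funcDeriv]

/-- **(3.31) in the interpolation parameter `t` of (3.30)**: `d/dt W(tg_k·H) = g_k · ⟨𝐕′(tg_k·H), H⟩` — the inner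
product (3.31) times the factor `g_k` standing in front of `∫₀¹ dt` in (3.30). [cite: Balaban1988Convergent, (3.30) p.272,
(3.31) p.273] -/
theorem hasDerivAt_coupling {W : (β → Matrix n n ℂ) → ℂ} {φ : (β → Matrix n n ℂ) →L[ℂ] ℂ} {H : β → Matrix n n ℂ}
    (g : ℝ) {t : ℝ} (hW : HasFDerivAt W φ ((t * g) • H)) :
    HasDerivAt (fun t : ℝ => W ((t * g) • H)) (g * bondInner (funcDeriv φ) H) t := by
  have hc : HasDerivAt (fun t : ℝ => (t * g) • H) ((1 * g) • H) t := ((hasDerivAt_id t).mul_const g).smul_const H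
  have h : HasDerivAt (fun t : ℝ => W ((t * g) • H)) ((φ.restrictScalars ℝ) ((1 * g) • H)) t :=
    (hW.restrictScalars ℝ).comp_hasDerivAt t hc
  refine h.congr_deriv ?_
  rw [one_mul, ContinuousLinearMap.coe_restrictScalars', ContinuousLinearMap.map_smul_of_tower, Complex.real_smul,
    bondInner_funcDeriv]

/-- The sum form: for finitely many terms `W_l`, each differentiable at `s·H` with derivative `φ_l`,
`d/ds Σ_l W_l(s·H) = ⟨Σ_l 𝐕′_l, H⟩` — *"where 𝐕_k′ is the sum of all the functional derivatives"*.
[cite: Balaban1988Convergent, (3.31) p.273] -/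
theorem hasDerivAt_ray_sum {ι : Type*} (S : Finset ι) {W : ι → (β → Matrix n n ℂ) → ℂ}
    {φ : ι → (β → Matrix n n ℂ) →L[ℂ] ℂ} {H : β → Matrix n n ℂ} {s : ℝ} (hW : ∀ l ∈ S, HasFDerivAt (W l) (φ l) (s • H)) :
    HasDerivAt (fun s : ℝ => ∑ l ∈ S, W l (s • H)) (bondInner (∑ l ∈ S, funcDeriv (φ l)) H) s := by
  have h : HasDerivAt (fun s : ℝ => ∑ l ∈ S, W l (s • H)) (∑ l ∈ S, bondInner (funcDeriv (φ l)) H) s :=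
    HasDerivAt.fun_sum fun l hl => hasDerivAt_ray (hW l hl)
  refine h.congr_deriv ?_
  rw [← funcDeriv_sum, bondInner_funcDeriv, _root_.sum_apply]
  exact Finset.sum_congr rfl fun l _ => bondInner_funcDeriv (φ l) H

end Ray

end Literature.MathematicalPhysics.QuantumFieldTheory.Balaban1983to89.B14.Eq331ChainRule
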